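import Literature.Geometry.Riemannian.BarrierMinimumPrinciple
import Literature.Geometry.Riemannian.ShrinkerMinimumPrincipleCalculus
import Literature.Geometry.Riemannian.NonTrappingConvexSublevelProofs
import Literature.Geometry.Riemannian.ExpMapEnergyTaylor
import Literature.Geometry.Riemannian.MaximalGeodesicRescaling
import Literature.Geometry.Riemannian.VolumeSphereTheoremJacobiFrameProofs
import HarnessLib

/-!
# The parabolic minimum principle on `M × M × [t₁, t₂]` against supersolutions given by
# DIRECTIONAL second-order upper barriers along geodesics (the comparison step of Bamler 2020a,
# Cor. 3.6, in the form matching the second variation of arc length)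

Companion of `BarrierMinimumPrinciple.lean`. There the supersolution property of `ψ` was an upper
barrier FUNCTION `b ≥ ψ` near the point with `∂ₜb − Δ_x b − Δ_y b ≥ −c − η`. Here — matching what
the second variation formula actually delivers for `ψ = d_t²` (Bamler 2020a, proof of Thm. 3.5;
cf. the tree's `HaslhoferMuller.edist_toReal_le_taylor`) — the datum at `(x, y, t)` is
DIRECTIONAL: `h(t)`-orthonormal frames `(eˣᵢ)` at `x`, `(eʸᵢ)` at `y`, one-variable upper
barriers `Bˣᵢ(σ) ≥ ψ(exp_x(σ eˣᵢ), y, t)`, `Bʸᵢ(σ) ≥ ψ(x, exp_y(σ eʸᵢ), t)` for `σ` near `0`,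
touching at `σ = 0`, twice differentiable at `0` with second derivatives `bˣᵢ`, `bʸᵢ`, and a
time barrier `Bᵗ(t') ≥ ψ(x, y, t')` for `t' < t` near `t`, touching, with left derivative `p`
at `t`, subject to `p − Σᵢ bˣᵢ − Σᵢ bʸᵢ ≥ −c − η`.

* `laplaceBeltrami_eq_sum_hessian` — `Δ_g F(x) = Σᵢ Hess F(eᵢ, eᵢ)` in a `g_x`-orthonormal frame
  (general model; cf. `Zhang2009.trace_eq_sum_of_orthonormal`);
* `hessian_le_of_directional_barrier` — if `B(σ) − F(exp_x(σ v))` has a local minimum at `0`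
  then `Hess F(v, v) ≤ B″(0)` (the second derivative of `F` along the geodesic is the Hessian,
  `hasDerivAt_mvfderiv_velocity_of_isGeodesicOn`);
* `hasDerivWithinAt_nonpos_of_isLocalMin_left` — one-sided first-order condition;
* `directional_barrier_minimum_principle` — for `U` continuous on the slab with `C²` slices and
  `∂ₜU = Δ_x U + Δ_y U` (genuine derivative) on `(t₁, t₂]`, `U(t₁) ≤ ψ(t₁)`, and `ψ` continuous
  with the directional datum at every `(x, y, t)`, `t ∈ (t₁, t₂]`, for every `η > 0`:
  `U ≤ ψ + c (t − t₁)`.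

Everything is proved; no definitions, no named facts.

## References

* R. H. Bamler, *Entropy and heat kernel bounds on a Ricci flow background*, arXiv:2008.07093
  (2020), §3, proof of Thm. 3.5 and Cor. 3.6. [Bamler2020Entropy]
* E. Calabi, *An extension of E. Hopf's maximum principle*, Duke Math. J. 25 (1958).
-/

noncomputable section

open Bundle Set Function Filter Manifold TopologicalSpace
open scoped Manifold ContDiff Topology

namespace Literature.Geometry.Riemannian

open Lorentzian Lorentzian.PseudoRiemannianMetric

section Frame

variable {E : Type*} [NormedAddCommGroup E] [NormedSpace ℝ E] [FiniteDimensional ℝ E]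
  [CompleteSpace E] {H : Type*} [TopologicalSpace H] {I : ModelWithCorners ℝ E H}
  {M : Type*} [TopologicalSpace M] [ChartedSpace H M] [IsManifold I ∞ M]

/-- **`Δ_g F (x) = Σᵢ Hess F (eᵢ, eᵢ)`** for a `g_x`-orthonormal family `e` with `card ι = dim M`
(`Δ_g = tr_g Hess`, `tr_g T = Σᵢ T(eᵢ, eᵢ)` since `g(♯α, w) = α w`). [folklore] -/
theorem laplaceBeltrami_eq_sum_hessian {ι : Type*} [Fintype ι] [DecidableEq ι]
    (g : PseudoRiemannianMetric I ∞ E (TangentSpace I : M → Type _)) [g.HasLeviCivita] (x : M)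
    {e : ι → TangentSpace I x} (hon : ∀ i j, g.val x (e i) (e j) = if i = j then 1 else 0)
    (hcard : Fintype.card ι = Module.finrank ℝ E) (F : M → ℝ) :
    g.laplaceBeltrami F x = ∑ i, g.hessian F x (e i) (e i) := by
  rw [laplaceBeltrami_eq_dalembertian]
  show g.trace x (g.hessian F x) = _
  have h := trace_eq_sum_bilin_of_orthonormal (V := E) (g.val x) hon hcard
    ((g.sharp x).toLinearMap ∘ₗ (g.hessian F x))
  have h2 : g.trace x (g.hessian F x) =
      LinearMap.trace ℝ E ((g.sharp x).toLinearMap ∘ₗ g.hessian F x) := rfl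
  rw [h2, h]
  refine Finset.sum_congr rfl fun i _ ↦ ?_
  exact g.val_sharp_apply x (g.hessian F x (e i)) (e i)

end Frame

section Directional

variable {E : Type*} [NormedAddCommGroup E] [NormedSpace ℝ E] [FiniteDimensional ℝ E]
  [CompleteSpace E] {H : Type*} [TopologicalSpace H] {I : ModelWithCorners ℝ E H}
  {M : Type*} [TopologicalSpace M] [ChartedSpace H M] [IsManifold I ∞ M] [T2Space M]
  [BoundarylessManifold I M]

/-- **`Hess F(v, v) ≤ B″(0)` from a directional upper barrier**: if `F` is `C²` near `x`, the
Levi-Civita connection is geodesically complete, and `σ ↦ B(σ) − F(exp_x(σ v))` has a local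
minimum at `σ = 0` for a function `B` twice differentiable at `0` (derivative `B′` near `0`,
`B′′(0) = b`), then `Hess F_x(v, v) ≤ b` — the second derivative of `F` along the geodesic
`σ ↦ exp_x(σ v)` at `0` is `Hess F(v, v)` (`hasDerivAt_mvfderiv_velocity_of_isGeodesicOn`) and the
second-derivative test (`Zhang2009.deriv_eq_zero_and_nonneg_of_isLocalMin`). [folklore] -/
theorem hessian_le_of_directional_barrier
    (g : PseudoRiemannianMetric I ∞ E (TangentSpace I : M → Type _)) [g.HasLeviCivita]
    [CovariantDerivative.ContMDiffCovariantDerivative g.leviCivita 1]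
    (hc : IsGeodesicallyComplete g.leviCivita) {F : M → ℝ} {x : M}
    (hF : ∀ᶠ x' in 𝓝 x, ContMDiffAt I 𝓘(ℝ, ℝ) 2 F x') (v : TangentSpace I x)
    {B B' : ℝ → ℝ} {b : ℝ} (hB : ∀ᶠ σ in 𝓝 (0 : ℝ), HasDerivAt B (B' σ) σ) (hB2 : HasDerivAt B' b 0)
    (hmin : IsLocalMin (fun σ ↦ B σ - F (expMap g.leviCivita x (σ • v))) 0) :
    g.hessian F x v v ≤ b := by
  haveI : Fact ((1 : ℕ∞ω) ≤ (∞ : ℕ∞ω)) := ⟨by exact_mod_cast le_top⟩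
  set c : ℝ → M := fun σ ↦ expMap g.leviCivita x (σ • v) with hc_def
  have hgeo : IsGeodesic g.leviCivita c := isGeodesic_expMap_smul_of_isGeodesicallyComplete hc x v
  have hc0 : c 0 = x := by
    show expMap g.leviCivita x ((0 : ℝ) • v) = x
    rw [zero_smul]; exact expMap_zero (cov := g.leviCivita) x
  have hv0 : velocity I c 0 = v := velocity_expMap_smul_zero (cov := g.leviCivita) x v
  -- differentiability of `c`, and `F` is `C²` at `c σ` for `σ` near `0`
  have hcd : ∀ σ, MDifferentiableAt 𝓘(ℝ, ℝ) I c σ := fun σ ↦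
    IsGeodesicOn.mdifferentiableAt_holds (hgeo.isGeodesicOn univ) (mem_univ σ)
  have hcont : ContinuousAt c 0 := (hcd 0).continuousAt
  have hF' : ∀ᶠ σ in 𝓝 (0 : ℝ), ContMDiffAt I 𝓘(ℝ, ℝ) 2 F (c σ) := by
    have : Tendsto c (𝓝 0) (𝓝 x) := hc0 ▸ hcont
    exact this.eventually hF
  have hF0 : ContMDiffAt I 𝓘(ℝ, ℝ) 2 F (c 0) := hF'.self_of_nhds
  -- first derivative of `h = B − F ∘ c` near `0`
  have hd : ∀ᶠ σ in 𝓝 (0 : ℝ), HasDerivAt (fun σ ↦ B σ - F (c σ))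
      ((fun σ ↦ B' σ - mvfderiv I F (c σ) (velocity I c σ)) σ) σ := by
    filter_upwards [hB, hF'] with σ hBσ hFσ
    exact hBσ.sub (hasDerivAt_comp_curve_mvfderiv (hFσ.mdifferentiableAt (by simp)) (hcd σ))
  -- second derivative at `0`
  have hd2 : HasDerivAt (fun σ ↦ B' σ - mvfderiv I F (c σ) (velocity I c σ))
      (b - g.hessian F (c 0) (velocity I c 0) (velocity I c 0)) 0 :=
    hB2.sub (g.hasDerivAt_mvfderiv_velocity_of_isGeodesicOn (hgeo.isGeodesicOn univ) (mem_univ 0) hF0)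
  obtain ⟨-, h2⟩ := Zhang2009.deriv_eq_zero_and_nonneg_of_isLocalMin hmin hd hd2
  rw [hv0] at h2
  rw [hc0] at h2
  linarith

/-- **`φ′(t₀) ≤ 0` (derivative within `(-∞, t₀]`) at a minimum from the left.** [folklore] -/
theorem hasDerivWithinAt_nonpos_of_isLocalMin_left {φ : ℝ → ℝ} {t₀ d : ℝ}
    (hφ : HasDerivWithinAt φ d (Iic t₀) t₀) (hmin : ∀ᶠ t in 𝓝[<] t₀, φ t₀ ≤ φ t) : d ≤ 0 := by
  have hslope : Tendsto (slope φ t₀) (𝓝[<] t₀) (𝓝 d) := by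
    have := hasDerivWithinAt_iff_tendsto_slope.1 hφ
    rwa [Iic_sdiff_right] at this
  refine le_of_tendsto hslope ?_
  filter_upwards [hmin, self_mem_nhdsWithin] with t ht ht'
  rw [slope_def_field]
  have ht'' : t < t₀ := ht'
  exact div_nonpos_of_nonneg_of_nonpos (by linarith) (by linarith)

end Directional

section Comparison

variable {E : Type*} [NormedAddCommGroup E] [NormedSpace ℝ E] [FiniteDimensional ℝ E]
  [CompleteSpace E] {H : Type*} [TopologicalSpace H] {I : ModelWithCorners ℝ E H} [I.Boundaryless]
  {M : Type*} [TopologicalSpace M] [ChartedSpace H M] [IsManifold I ∞ M] [T2Space M] [CompactSpace M]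
  {h : ℝ → PseudoRiemannianMetric I ∞ E (TangentSpace I : M → Type _)}

/-- **The minimum principle against a supersolution given by directional upper barriers** (the
comparison step of Bamler 2020a, Cor. 3.6, in second-variation form). Let `h` be a family of
Riemannian metrics on a compact manifold without boundary, `ψ, U : M → M → ℝ → ℝ` continuous on
`M × M × [t₁, t₂]`, `U` with `C²` slices in `x` and `y` and `∂ₜU = Δ_x U + Δ_y U` at every
`(x, y, t)`, `t ∈ (t₁, t₂]`, and `U(t₁) ≤ ψ(t₁)`. Suppose that at every `(x, y, t)`,
`t ∈ (t₁, t₂]`, and for every `η > 0` there are `h(t)`-orthonormal frames `eˣ` at `x`, `eʸ` at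
`y`, one-variable upper barriers `Bˣᵢ ≥ ψ(exp_x(σ eˣᵢ), y, t)`, `Bʸᵢ ≥ ψ(x, exp_y(σ eʸᵢ), t)` near
`σ = 0`, touching, twice differentiable at `0` with second derivatives `bˣᵢ`, `bʸᵢ`, and a time
barrier `Bᵗ ≥ ψ(x, y, ·)` on the left of `t`, touching, with left derivative `p`, such that
`p − Σ bˣᵢ − Σ bʸᵢ ≥ −c − η`. Then `U ≤ ψ + c (t − t₁)` on `M × M × [t₁, t₂]`.
[cite: Bamler2020Entropy, §3, proof of Cor. 3.6] -/
theorem directional_barrier_minimum_principle [∀ r, (h r).HasLeviCivita]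
    (hR : ∀ r, (h r).IsRiemannian) {t₁ t₂ : ℝ}
    {ψ U : M → M → ℝ → ℝ}
    (hψc : ContinuousOn (fun p : M × M × ℝ ↦ ψ p.1 p.2.1 p.2.2) (univ ×ˢ univ ×ˢ Icc t₁ t₂))
    (hUc : ContinuousOn (fun p : M × M × ℝ ↦ U p.1 p.2.1 p.2.2) (univ ×ˢ univ ×ˢ Icc t₁ t₂))
    (hUx : ∀ y, ∀ t ∈ Ioc t₁ t₂, ContMDiff I 𝓘(ℝ, ℝ) 2 fun x ↦ U x y t)
    (hUy : ∀ x, ∀ t ∈ Ioc t₁ t₂, ContMDiff I 𝓘(ℝ, ℝ) 2 fun y ↦ U x y t)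
    (hUt : ∀ x y, ∀ t ∈ Ioc t₁ t₂, HasDerivAt (fun s ↦ U x y s)
      ((h t).laplaceBeltrami (fun x' ↦ U x' y t) x + (h t).laplaceBeltrami (fun y' ↦ U x y' t) y) t)
    {c : ℝ}
    (hbar : ∀ x y, ∀ t ∈ Ioc t₁ t₂, ∀ η > 0,
      ∃ (ex : Fin (Module.finrank ℝ E) → TangentSpace I x)
        (ey : Fin (Module.finrank ℝ E) → TangentSpace I y)
        (Bx Bx' By By' : Fin (Module.finrank ℝ E) → ℝ → ℝ)
        (bx by_ : Fin (Module.finrank ℝ E) → ℝ) (Bt : ℝ → ℝ) (p : ℝ),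
        (∀ i j, (h t).val x (ex i) (ex j) = if i = j then 1 else 0) ∧
        (∀ i j, (h t).val y (ey i) (ey j) = if i = j then 1 else 0) ∧
        (∀ i, (∀ᶠ σ in 𝓝 (0 : ℝ), HasDerivAt (Bx i) (Bx' i σ) σ) ∧ HasDerivAt (Bx' i) (bx i) 0 ∧
          Bx i 0 = ψ x y t ∧
          ∀ᶠ σ in 𝓝 (0 : ℝ), ψ (expMap (h t).leviCivita x (σ • ex i)) y t ≤ Bx i σ) ∧
        (∀ i, (∀ᶠ σ in 𝓝 (0 : ℝ), HasDerivAt (By i) (By' i σ) σ) ∧ HasDerivAt (By' i) (by_ i) 0 ∧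
          By i 0 = ψ x y t ∧
          ∀ᶠ σ in 𝓝 (0 : ℝ), ψ x (expMap (h t).leviCivita y (σ • ey i)) t ≤ By i σ) ∧
        (HasDerivWithinAt Bt p (Iic t) t ∧ Bt t = ψ x y t ∧ ∀ᶠ t' in 𝓝[<] t, ψ x y t' ≤ Bt t') ∧
        -c - η ≤ p - ∑ i, bx i - ∑ i, by_ i)
    (h0 : ∀ x y, U x y t₁ ≤ ψ x y t₁) :
    ∀ x y, ∀ t ∈ Icc t₁ t₂, U x y t ≤ ψ x y t + c * (t - t₁) := by
  haveI : Fact ((1 : ℕ∞ω) ≤ (∞ : ℕ∞ω)) := ⟨by exact_mod_cast le_top⟩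
  have h2 : (2 : ℕ∞ω) ≤ (∞ : ℕ∞ω) := WithTop.coe_le_coe.mpr le_top
  -- it suffices to prove the bound with `c + δ` for every `δ > 0`
  suffices hδ : ∀ δ > 0, ∀ x y, ∀ t ∈ Icc t₁ t₂, U x y t ≤ ψ x y t + (c + δ) * (t - t₁) by
    intro x y t ht
    refine le_of_forall_pos_le_add fun ε hε ↦ ?_
    rcases eq_or_lt_of_le ht.1 with heq | hlt
    · subst heq; have := h0 x y; linarith
    · have := hδ (ε / (t - t₁)) (by positivity) x y t ht
      rw [add_mul, div_mul_cancel₀ _ (by linarith)] at this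
      linarith
  intro δ hδ x y t ht
  by_contra hneg
  rw [not_le] at hneg
  -- `W = ψ + (c + δ)(t − t₁) − U` attains a negative minimum on the compact slab
  set K : Set (M × M × ℝ) := univ ×ˢ univ ×ˢ Icc t₁ t₂ with hK
  have hKc : IsCompact K := isCompact_univ.prod (isCompact_univ.prod isCompact_Icc)
  set W : M × M × ℝ → ℝ := fun p ↦ ψ p.1 p.2.1 p.2.2 + (c + δ) * (p.2.2 - t₁) - U p.1 p.2.1 p.2.2 with hW
  have hWc : ContinuousOn W K :=
    (hψc.add (continuousOn_const.mul ((continuous_snd.comp continuous_snd).continuousOn.sub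
      continuousOn_const))).sub hUc
  obtain ⟨p₀, hp₀K, hp₀⟩ := hKc.exists_isMinOn ⟨(x, y, t), mem_univ _, mem_univ _, ht⟩ hWc
  have hWneg : W p₀ < 0 := by
    have h1 : W p₀ ≤ W (x, y, t) := hp₀ (show ((x, y, t) : M × M × ℝ) ∈ K from ⟨mem_univ _, mem_univ _, ht⟩)
    have h2' : W (x, y, t) < 0 := by simp only [hW]; linarith
    exact h1.trans_lt h2'
  obtain ⟨x₀, y₀, t₀⟩ := p₀
  obtain ⟨-, -, ht₀⟩ := hp₀K
  simp only at ht₀ hWneg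
  have ht₀1 : t₁ < t₀ := by
    rcases eq_or_lt_of_le ht₀.1 with heq | hlt
    · exfalso
      have := h0 x₀ y₀
      simp only [hW, ← heq, sub_self, mul_zero, add_zero] at hWneg
      linarith
    · exact hlt
  have ht₀' : t₀ ∈ Ioc t₁ t₂ := ⟨ht₀1, ht₀.2⟩
  -- the minimum property against points of the slab
  have hmin : ∀ x' y', ∀ t' ∈ Icc t₁ t₂, W (x₀, y₀, t₀) ≤ W (x', y', t') := fun x' y' t' ht' ↦
    hp₀ (show ((x', y', t') : M × M × ℝ) ∈ K from ⟨mem_univ _, mem_univ _, ht'⟩)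
  -- the directional datum at `(x₀, y₀, t₀)` with `η = δ/2`
  obtain ⟨ex, ey, Bx, Bx', By, By', bx, by_, Bt, p, hexon, heyon, hBx, hBy, ⟨hBt, hBt0, hBtdom⟩, hineq⟩ :=
    hbar x₀ y₀ t₀ ht₀' (δ / 2) (by positivity)
  -- geometry of `h t₀`
  set g := h t₀ with hg_def
  haveI : CovariantDerivative.ContMDiffCovariantDerivative g.leviCivita 1 :=
    contMDiffCovariantDerivative_leviCivita_of_two_le g h2
  have hcpl : IsGeodesicallyComplete g.leviCivita := isGeodesicallyComplete_of_compactSpace g h2 (hR t₀)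
  have hcard : Fintype.card (Fin (Module.finrank ℝ E)) = Module.finrank ℝ E := Fintype.card_fin _
  -- (i) `x`-directions: `Hess_x U (eˣᵢ, eˣᵢ) ≤ bˣᵢ`
  have hix : ∀ i, g.hessian (fun x' ↦ U x' y₀ t₀) x₀ (ex i) (ex i) ≤ bx i := by
    intro i
    obtain ⟨hB1, hB2, hB0, hdom⟩ := hBx i
    refine hessian_le_of_directional_barrier g hcpl (Eventually.of_forall fun x' ↦ hUx y₀ t₀ ht₀' x')
      (ex i) hB1 hB2 ?_
    -- local minimum of `Bx i σ − U(exp(σ eˣᵢ), y₀, t₀)` at `0`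
    filter_upwards [hdom] with σ hσ
    have hexp0 : expMap g.leviCivita x₀ ((0 : ℝ) • ex i) = x₀ := by
      rw [zero_smul]; exact expMap_zero (cov := g.leviCivita) x₀
    have h1 := hmin (expMap g.leviCivita x₀ (σ • ex i)) y₀ t₀ ht₀
    simp only [hW] at h1
    have key : Bx i 0 - U x₀ y₀ t₀ ≤ Bx i σ - U (expMap g.leviCivita x₀ (σ • ex i)) y₀ t₀ := by
      rw [hB0]; linarith
    simpa only [hexp0] using key
  -- (ii) `y`-directions
  have hiy : ∀ i, g.hessian (fun y' ↦ U x₀ y' t₀) y₀ (ey i) (ey i) ≤ by_ i := by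
    intro i
    obtain ⟨hB1, hB2, hB0, hdom⟩ := hBy i
    refine hessian_le_of_directional_barrier g hcpl (Eventually.of_forall fun y' ↦ hUy x₀ t₀ ht₀' y')
      (ey i) hB1 hB2 ?_
    filter_upwards [hdom] with σ hσ
    have hexp0 : expMap g.leviCivita y₀ ((0 : ℝ) • ey i) = y₀ := by
      rw [zero_smul]; exact expMap_zero (cov := g.leviCivita) y₀
    have h1 := hmin x₀ (expMap g.leviCivita y₀ (σ • ey i)) t₀ ht₀
    simp only [hW] at h1
    have key : By i 0 - U x₀ y₀ t₀ ≤ By i σ - U x₀ (expMap g.leviCivita y₀ (σ • ey i)) t₀ := by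
      rw [hB0]; linarith
    simpa only [hexp0] using key
  -- the Laplacians are the frame sums of the Hessians
  have hLx : g.laplaceBeltrami (fun x' ↦ U x' y₀ t₀) x₀ ≤ ∑ i, bx i := by
    rw [laplaceBeltrami_eq_sum_hessian g x₀ hexon hcard]
    exact Finset.sum_le_sum fun i _ ↦ hix i
  have hLy : g.laplaceBeltrami (fun y' ↦ U x₀ y' t₀) y₀ ≤ ∑ i, by_ i := by
    rw [laplaceBeltrami_eq_sum_hessian g y₀ heyon hcard]
    exact Finset.sum_le_sum fun i _ ↦ hiy i
  -- (iii) time: minimum from the left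
  have hit : p + (c + δ) - (g.laplaceBeltrami (fun x' ↦ U x' y₀ t₀) x₀ +
      g.laplaceBeltrami (fun y' ↦ U x₀ y' t₀) y₀) ≤ 0 := by
    have hd : HasDerivWithinAt (fun s ↦ Bt s + (c + δ) * (s - t₁) - U x₀ y₀ s)
        (p + (c + δ) - (g.laplaceBeltrami (fun x' ↦ U x' y₀ t₀) x₀ +
          g.laplaceBeltrami (fun y' ↦ U x₀ y' t₀) y₀)) (Iic t₀) t₀ := by
      have h1 := (hBt.add ((((hasDerivAt_id t₀).sub_const t₁).const_mul (c + δ)).hasDerivWithinAt)).sub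
        (hUt x₀ y₀ t₀ ht₀').hasDerivWithinAt
      simp only [mul_one] at h1
      exact h1
    refine hasDerivWithinAt_nonpos_of_isLocalMin_left hd ?_
    have h2' : ∀ᶠ s in 𝓝[<] t₀, s ∈ Icc t₁ t₂ := by
      filter_upwards [Ioo_mem_nhdsLT ht₀1] with s hs
      exact ⟨hs.1.le, hs.2.le.trans ht₀.2⟩
    filter_upwards [hBtdom, h2'] with s hs hsI
    have h1 := hmin x₀ y₀ s hsI
    simp only [hW] at h1
    rw [hBt0]
    linarith
  -- contradiction
  linarith

end Comparison

end Literature.Geometry.Riemannian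

end
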